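import Literature.Barriers.ValiantsHypothesis.FSV18UniversalConstructions
import Literature.Computability.AlgebraicComplexity.UniversalCircuit
import Literature.Computability.AlgebraicComplexity.ValiantClassesProofs
import HarnessLib

/-!
# FSV18 §3 — the named facts `FSV2018_thm12`, `FSV2018_lemma13`, `FSV2018_cor15` DISCHARGED

Companion of `FSV18UniversalConstructions.lean` (cell `val-lit`, typer t18), whose three named
facts are Forbes–Shpilka–Volk 2018, Thm. 12 (ToC Thm. 3.1: the universal circuit), Lemma 13
(ToC Lemma 3.2: succinct hitting sets give succinct generators) and Cor. 15 (ToC Cor. 3.4: any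
succinct hitting set gives explicit quasi-polynomial hitting sets, in the tree's regime). All three
are PROVED here from the tree's universal circuit over an arbitrary commutative semiring,
`Literature.Computability.AlgebraicComplexity.RazUniversal.exists_universalCircuit`
(`UniversalCircuit.lean`: Raz's universal circuit-graph flattened to one polynomial, one copy per
degree, homogeneous parts by BCS Lemma 21.25):

* `FSV2018_thm12_holds` — with the uniform exponent `c = 67`
  (`9376 (n+d+s+2)²⁶, 21877 (n+d+s+2)²⁶ ≤ (n+d+s)⁶⁷` for `n, s ≥ 1`; `deg_y ≤ 3d+1 ≤ (d+2)⁶⁷`).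
* `FSV2018_lemma13_holds` — Thm. 12 + t18's proved core
  `IsSuccinctHittingSet.isHittingSetGenerator_of_covers`; succinctness of the generator
  `G = coeff_x(U)` because `U(x, α)` is a projection of `U` (`complexity_le_of_isProjection`) of
  `x`-degree `≤ d`.
* `FSV2018_cor15_holds` — Thm. 12 at `d = n`, `s = n^b` + t18's proved counting form of Lemma 14
  (`FSV2018.exists_finset_hittingSet_of_generator`) with `|S| = δΔ + 1` interpolation points from
  `Infinite F`; `b' = 26 b + 108`, `c = 26 b + a + 112` absorb the constants.

Helper lemmas (private): the coefficients of the flattening `sumAlgEquiv`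
(`coeff_y (coeff_x (sumAlgEquiv U)) = coeff_{x ⊔ y} U`), hence `coeff_x U(x, α) = (coeff_x (sumAlgEquiv U))(α)`,
`deg U(x, α) ≤ d` when every monomial of `U` has `x`-degree `≤ d`, and
`deg (coeff_x (sumAlgEquiv U)) ≤ deg U`.

Honest framing: discharges of PRINTED theorems of the natural-proofs framework; nothing here bears
on FSV Question 6 / `SuccinctHittingSetsForVP` or on VP ≠ VNP.

## References

* [ForbesShpilkaVolk2018] M. A. Forbes, A. Shpilka, B. L. Volk, *Succinct hitting sets and barriers
  to proving lower bounds for algebraic circuits*, Theory Comput. 14 (2018): Thm. 12 (ToC 3.1),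
  Lemma 13 (ToC 3.2), Lemma 14 (ToC 3.3), Cor. 15 (ToC 3.4), pp. 19–20. Locators as in
  `FSV18UniversalConstructions.lean`: paper:arxiv-1701.05328 p0014.txt:L9/L22/L36, p0015.txt:L7.
* [Raz2010] R. Raz, Theory Comput. 6 (2010), Prop. 3.3.
-/

noncomputable section

namespace Literature.Barriers.ValiantsHypothesis

open Literature.Computability.AlgebraicComplexity MvPolynomial

namespace FSV2018

/-! ### Coefficients of the flattening `R[x ⊕ y] ≃ (R[y])[x]` -/

section Flattening

variable {R : Type*} [CommSemiring R] {σ τ : Type*}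

/-- `coeff_y (coeff_x (sumAlgEquiv U)) = coeff_{(x, y)} U`. [folklore] -/
private theorem coeff_coeff_sumAlgEquiv (U : MvPolynomial (σ ⊕ τ) R) (ex : σ →₀ ℕ) (ey : τ →₀ ℕ) :
    coeff ey (coeff ex (sumAlgEquiv R σ τ U)) =
      coeff (Finsupp.sumFinsuppAddEquivProdFinsupp.symm (ex, ey)) U := by
  simp [sumAlgEquiv, coeff, AddMonoidAlgebra.curryAlgEquiv, AddMonoidAlgebra.curryRingEquiv,
    AddMonoidAlgebra.curryAddEquiv, Finsupp.curry_apply]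

/-- Specialising the `y`-variables to constants is `map (eval α)` on the flattening. [folklore] -/
private theorem aeval_sumElim_symm_sumAlgEquiv (α : τ → R) (P : MvPolynomial σ (MvPolynomial τ R)) :
    aeval (Sum.elim X fun j => C (α j)) ((sumAlgEquiv R σ τ).symm P) =
      MvPolynomial.map (eval α) P := by
  -- adapted from RazUniversalJoint.lean (aeval_labels_symm_sumAlgEquiv), labels `τ` general
  set F : MvPolynomial σ (MvPolynomial τ R) →+* MvPolynomial σ R :=
    (aeval (Sum.elim X fun j => C (α j)) :
        MvPolynomial (σ ⊕ τ) R →ₐ[R] MvPolynomial σ R).toRingHom.comp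
      ((sumAlgEquiv R σ τ).symm :
        MvPolynomial σ (MvPolynomial τ R) →ₐ[R] MvPolynomial (σ ⊕ τ) R).toRingHom
    with hF
  have key : F = MvPolynomial.map (eval α) := by
    refine MvPolynomial.ringHom_ext (fun a => ?_) (fun t => ?_)
    · have hc : F.comp (C : MvPolynomial τ R →+* MvPolynomial σ (MvPolynomial τ R)) =
          (C : R →+* MvPolynomial σ R).comp (eval α) := by
        refine MvPolynomial.ringHom_ext (fun c => ?_) (fun l => ?_)
        · show aeval (Sum.elim X fun j => C (α j)) ((sumAlgEquiv R σ τ).symm (C (C c))) =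
            C (eval α (C c))
          rw [sumAlgEquiv_symm_C_C, eval_C, aeval_C, algebraMap_eq]
        · show aeval (Sum.elim X fun j => C (α j)) ((sumAlgEquiv R σ τ).symm (C (X l))) =
            C (eval α (X l))
          rw [sumAlgEquiv_symm_C_X, eval_X, aeval_X, Sum.elim_inr]
      have := RingHom.congr_fun hc a
      show _ = MvPolynomial.map (eval α) (C a)
      rw [map_C]
      exact this
    · show aeval (Sum.elim X fun j => C (α j)) ((sumAlgEquiv R σ τ).symm (X t)) =
        MvPolynomial.map (eval α) (X t)
      rw [sumAlgEquiv_symm_X, aeval_X, Sum.elim_inl, map_X]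
  show F P = _
  rw [key]

/-- `coeff_x U(x, α) = (coeff_x (sumAlgEquiv U))(α)`. [folklore] -/
private theorem coeff_aeval_sumElim (α : τ → R) (U : MvPolynomial (σ ⊕ τ) R) (m : σ →₀ ℕ) :
    coeff m (aeval (Sum.elim X fun j => C (α j)) U) = eval α (coeff m (sumAlgEquiv R σ τ U)) := by
  conv_lhs => rw [← (sumAlgEquiv R σ τ).symm_apply_apply U]
  rw [aeval_sumElim_symm_sumAlgEquiv, coeff_map]

/-- The `y`-degree of a coefficient of the flattening is at most the total degree. [folklore] -/
private theorem totalDegree_coeff_sumAlgEquiv_le (U : MvPolynomial (σ ⊕ τ) R) (m : σ →₀ ℕ) :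
    (coeff m (sumAlgEquiv R σ τ U)).totalDegree ≤ U.totalDegree := by
  rw [totalDegree]
  refine Finset.sup_le fun ey hey => ?_
  have hU : Finsupp.sumFinsuppAddEquivProdFinsupp.symm (m, ey) ∈ U.support := by
    rw [mem_support_iff] at hey ⊢
    rwa [← coeff_coeff_sumAlgEquiv]
  refine le_trans ?_ (le_totalDegree hU)
  simp only [Finsupp.sumFinsuppAddEquivProdFinsupp_symm_apply]
  rw [Finsupp.sum_sumElim]
  exact Nat.le_add_left _ _

/-- If every monomial of `U` has `x`-degree `≤ d`, every specialisation `U(x, α)` has total degree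
`≤ d`. [folklore] -/
private theorem totalDegree_aeval_sumElim_le [Fintype σ] {U : MvPolynomial (σ ⊕ τ) R} {d : ℕ}
    (hx : ∀ e ∈ U.support, ∑ i : σ, e (Sum.inl i) ≤ d) (α : τ → R) :
    (aeval (Sum.elim X fun j => C (α j)) U).totalDegree ≤ d := by
  classical
  rw [totalDegree]
  refine Finset.sup_le fun m hm => ?_
  rw [mem_support_iff, coeff_aeval_sumElim] at hm
  have hQ : coeff m (sumAlgEquiv R σ τ U) ≠ 0 := fun h => hm (by rw [h, map_zero])
  obtain ⟨ey, hey⟩ := ne_zero_iff.mp hQ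
  rw [coeff_coeff_sumAlgEquiv] at hey
  have hsupp : Finsupp.sumFinsuppAddEquivProdFinsupp.symm (m, ey) ∈ U.support :=
    mem_support_iff.mpr hey
  have h := hx _ hsupp
  have hm' : (m.sum fun _ e => e) = ∑ i : σ, m i := by
    rw [Finsupp.sum_fintype _ _ (fun _ => rfl)]
  rw [hm']
  refine le_trans (le_of_eq ?_) h
  refine Finset.sum_congr rfl fun i _ => ?_
  simp

end Flattening

/-! ### Arithmetic -/

section Arithmetic

/-- `K (m+2)²⁶ ≤ m⁶⁷` for `m ≥ 2`, `K ≤ 2¹⁵`. [folklore] -/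
private theorem absorb {m : ℕ} (hm : 2 ≤ m) (K : ℕ) (hK : K ≤ 2 ^ 15) :
    K * (m + 2) ^ 26 ≤ m ^ 67 := by
  have h1 : m + 2 ≤ m ^ 2 := by nlinarith
  have h2 : (m + 2) ^ 26 ≤ (m ^ 2) ^ 26 := Nat.pow_le_pow_left h1 26
  have h3 : K ≤ m ^ 15 := hK.trans (Nat.pow_le_pow_left hm 15)
  calc K * (m + 2) ^ 26 ≤ m ^ 15 * (m ^ 2) ^ 26 := Nat.mul_le_mul h3 h2
    _ = m ^ 67 := by ring

/-- `3d + 1 ≤ (d+2)⁶⁷`. [folklore] -/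
private theorem three_mul_add_one_le (d : ℕ) : 3 * d + 1 ≤ (d + 2) ^ 67 := by
  have h1 : 3 * d + 1 ≤ (d + 2) ^ 2 := by nlinarith
  exact h1.trans (Nat.pow_le_pow_right (by omega) (by norm_num))

/-- `3n + 1 ≤ 4ⁿ`. [folklore] -/
private theorem three_mul_add_one_le_four_pow (n : ℕ) : 3 * n + 1 ≤ 4 ^ n := by
  induction n with
  | zero => simp
  | succ n ih =>
    have : 1 ≤ 4 ^ n := Nat.one_le_pow _ _ (by norm_num)
    rw [pow_succ]
    omega

/-- The size of the universal circuit at `d = n`, `s = n^b` is `≤ n^(26b+108)` for `n ≥ 2`.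
[folklore] -/
private theorem cor15_poly {n b : ℕ} (hn : 2 ≤ n) :
    21877 * (n + n + n ^ b + 2) ^ 26 ≤ n ^ (26 * b + 108) := by
  have h1n : 1 ≤ n := by omega
  have hb1 : n ≤ n ^ (b + 1) := by
    calc n = n ^ 1 := (pow_one n).symm
      _ ≤ n ^ (b + 1) := Nat.pow_le_pow_right h1n (by omega)
  have hb2 : n ^ b ≤ n ^ (b + 1) := Nat.pow_le_pow_right h1n (by omega)
  have hsum : n + n + n ^ b + 2 ≤ 4 * n ^ (b + 1) := by omega
  have hK : 21877 ≤ n ^ 15 := le_trans (by norm_num) (Nat.pow_le_pow_left hn 15)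
  have h4 : (4 : ℕ) ^ 26 ≤ n ^ 52 := by
    calc (4 : ℕ) ^ 26 = 2 ^ 52 := by norm_num
      _ ≤ n ^ 52 := Nat.pow_le_pow_left hn 52
  calc 21877 * (n + n + n ^ b + 2) ^ 26 ≤ n ^ 15 * (4 * n ^ (b + 1)) ^ 26 :=
        Nat.mul_le_mul hK (Nat.pow_le_pow_left hsum 26)
    _ = n ^ 15 * (4 ^ 26 * n ^ (26 * (b + 1))) := by rw [mul_pow, ← pow_mul]; ring_nf
    _ ≤ n ^ 15 * (n ^ 52 * n ^ (26 * (b + 1))) := by gcongr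
    _ = n ^ (26 * b + 93) := by rw [← pow_add, ← pow_add]; ring_nf
    _ ≤ n ^ (26 * b + 108) := Nat.pow_le_pow_right h1n (by omega)

/-- `2a + 3 ≤ 2^(a+2)`. [folklore] -/
private theorem two_mul_add_three_le_two_pow (a : ℕ) : 2 * a + 3 ≤ 2 ^ (a + 2) := by
  induction a with
  | zero => norm_num
  | succ a ih => rw [pow_succ]; omega

/-- The number of grid points `((3n+1)·C(2n,n)^a + 1)^p` is `≤ 2^(n^(26b+a+112))` when
`p ≤ n^(26b+108)`, `n ≥ 2`. [folklore] -/
private theorem cor15_card {n a b p : ℕ} (hn : 2 ≤ n) (hp : p ≤ n ^ (26 * b + 108)) :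
    ((3 * n + 1) * ((2 * n).choose n) ^ a + 1) ^ p ≤ 2 ^ (n ^ (26 * b + a + 112)) := by
  have h1n : 1 ≤ n := by omega
  -- the base is `≤ 2^(2n(a+1)+1)`
  have hC : ((2 * n).choose n) ^ a ≤ 2 ^ (2 * n * a) := by
    rw [pow_mul]; exact Nat.pow_le_pow_left (Nat.choose_le_two_pow _ _) a
  have h3 : 3 * n + 1 ≤ 2 ^ (2 * n) := by
    rw [pow_mul]; exact (three_mul_add_one_le_four_pow n).trans (by norm_num)
  have hbase : (3 * n + 1) * ((2 * n).choose n) ^ a + 1 ≤ 2 ^ (2 * n * (a + 1) + 1) := by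
    have hprod : (3 * n + 1) * ((2 * n).choose n) ^ a ≤ 2 ^ (2 * n * (a + 1)) := by
      calc (3 * n + 1) * ((2 * n).choose n) ^ a ≤ 2 ^ (2 * n) * 2 ^ (2 * n * a) :=
            Nat.mul_le_mul h3 hC
        _ = 2 ^ (2 * n * (a + 1)) := by rw [← pow_add]; ring_nf
    have h1 : 1 ≤ 2 ^ (2 * n * (a + 1)) := Nat.one_le_two_pow
    rw [pow_succ]
    omega
  -- the exponent: `(2n(a+1)+1) · p ≤ n^(a+3) · n^(26b+108)`
  have ha2 : 2 * a + 3 ≤ 2 ^ (a + 2) := two_mul_add_three_le_two_pow a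
  have hexp : 2 * n * (a + 1) + 1 ≤ n ^ (a + 3) := by
    calc 2 * n * (a + 1) + 1 ≤ n * (2 * a + 3) := by nlinarith
      _ ≤ n * 2 ^ (a + 2) := Nat.mul_le_mul_left n ha2
      _ ≤ n * n ^ (a + 2) := Nat.mul_le_mul_left n (Nat.pow_le_pow_left hn _)
      _ = n ^ (a + 3) := by ring
  calc ((3 * n + 1) * ((2 * n).choose n) ^ a + 1) ^ p
      ≤ (2 ^ (2 * n * (a + 1) + 1)) ^ p := Nat.pow_le_pow_left hbase p
    _ = 2 ^ ((2 * n * (a + 1) + 1) * p) := by rw [← pow_mul]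
    _ ≤ 2 ^ (n ^ (a + 3) * n ^ (26 * b + 108)) :=
        Nat.pow_le_pow_right (by norm_num) (Nat.mul_le_mul hexp hp)
    _ = 2 ^ (n ^ (26 * b + a + 111)) := by rw [← pow_add]; ring_nf
    _ ≤ 2 ^ (n ^ (26 * b + a + 112)) :=
        Nat.pow_le_pow_right (by norm_num) (Nat.pow_le_pow_right h1n (by omega))

end Arithmetic

/-! ### Projections of the universal circuit -/

section Projection

variable {R : Type*} [CommSemiring R] {σ τ : Type*}

/-- `U(x, α)` is a projection of `U`. [folklore] -/
private theorem isProjection_aeval_sumElim (U : MvPolynomial (σ ⊕ τ) R) (α : τ → R) :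
    IsProjection (aeval (Sum.elim X fun j => C (α j)) U) U := by
  refine ⟨Sum.elim X fun j => C (α j), fun i => ?_, rfl⟩
  cases i with
  | inl i => exact Or.inl ⟨i, rfl⟩
  | inr j => exact Or.inr ⟨α j, rfl⟩

/-- The `y`-degree of a monomial is at most its total degree. [folklore] -/
private theorem sum_inr_le_sum [Fintype σ] [Fintype τ] (e : σ ⊕ τ →₀ ℕ) :
    ∑ j : τ, e (Sum.inr j) ≤ e.sum fun _ k => k := by
  rw [Finsupp.sum_fintype _ _ (fun _ => rfl), Fintype.sum_sum_type]
  exact Nat.le_add_left _ _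

end Projection

end FSV2018

/-! ### The three named facts, discharged -/

/-- **FSV Thm. 12 (ToC Thm. 3.1), the universal circuit — DISCHARGED** (`c = 67`): from
`RazUniversal.exists_universalCircuit` (any commutative semiring, in particular every field).
[cite: ForbesShpilkaVolk2018, Thm. 12 (seq.) = ToC Thm. 3.1, p. 19]
locator: paper:arxiv-1701.05328 p0014.txt:L9 -/
theorem FSV2018_thm12_holds : FSV2018_thm12 := by
  refine ⟨67, fun F _ n s d hn hs => ?_⟩
  obtain ⟨p, U, hp, hU, hx, hdeg, hcov⟩ := RazUniversal.exists_universalCircuit F n s d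
  have hm2 : 2 ≤ n + d + s := by omega
  refine ⟨p, U, hp.trans (FSV2018.absorb hm2 9376 (by norm_num)),
    hU.trans (FSV2018.absorb hm2 21877 (by norm_num)), hx, fun e he => ?_, hcov⟩
  calc ∑ j : Fin p, e (Sum.inr j) ≤ e.sum (fun _ k => k) := FSV2018.sum_inr_le_sum e
    _ ≤ U.totalDegree := le_totalDegree he
    _ ≤ 3 * d + 1 := hdeg
    _ ≤ (d + 2) ^ 67 := FSV2018.three_mul_add_one_le d

/-- **FSV Lemma 13 (ToC Lemma 3.2) as printed — DISCHARGED** (`c = 67`): the generator is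
`G = coeff_x(U)` for the universal circuit `U` of Thm. 12; it is a hitting-set generator for `𝒟`
because its image contains the hitting set (`isHittingSetGenerator_of_covers`), and succinct
because every `U(x, α)` is a projection of `U` of `x`-degree `≤ d`.
[cite: ForbesShpilkaVolk2018, Lemma 13 (seq.) = ToC Lemma 3.2, p. 19]
locator: paper:arxiv-1701.05328 p0014.txt:L22 -/
theorem FSV2018_lemma13_holds : FSV2018_lemma13 := by
  refine ⟨67, fun F _ n s d hn hs 𝒟 hhit => ?_⟩
  obtain ⟨p, U, hp, hU, hx, hdeg, hcov⟩ := RazUniversal.exists_universalCircuit F n s d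
  have hm2 : 2 ≤ n + d + s := by omega
  let G : {m : Fin n →₀ ℕ | m.degree ≤ d} → MvPolynomial (Fin p) F := fun m =>
    coeff (m : Fin n →₀ ℕ) (sumAlgEquiv F (Fin n) (Fin p) U)
  have hUc : complexity U ≤ (n + d + s) ^ 67 := hU.trans (FSV2018.absorb hm2 21877 (by norm_num))
  refine ⟨p, G, hp.trans (FSV2018.absorb hm2 9376 (by norm_num)), ?_, ?_, U, hUc, fun m => rfl⟩
  · refine hhit.isHittingSetGenerator_of_covers fun f hf => ?_
    obtain ⟨α, hα⟩ := hcov f hf.1 hf.2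
    refine ⟨α, funext fun m => ?_⟩
    rw [genOutput_apply, coeffVector_apply, ← hα, FSV2018.coeff_aeval_sumElim]
  · intro α
    refine ⟨aeval (Sum.elim X fun j => C (α j)) U,
      ⟨FSV2018.totalDegree_aeval_sumElim_le hx α,
        (complexity_le_of_isProjection (FSV2018.isProjection_aeval_sumElim U α)).trans hUc⟩,
      funext fun m => ?_⟩
    rw [coeffVector_apply, genOutput_apply, FSV2018.coeff_aeval_sumElim]

/-- **FSV Cor. 15 (ToC Cor. 3.4) in the tree's regime — DISCHARGED**: the universal circuit at
`d = n`, `s = n^b` turns the hypothesised succinct hitting set `SmallCircuits F n b` into a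
succinct GENERATOR `G = coeff_x(U)` for `Distinguishers F n a` with outputs in
`SmallCircuits F n (26b+108)` and coordinates of degree `≤ 3n+1`; Lemma 14 in counting form
(`FSV2018.exists_finset_hittingSet_of_generator`, `(3n+1)·C(2n,n)^a + 1` interpolation points from
the infinite field) gives a succinct hitting set of size `≤ 2^(n^(26b+a+112))`.
[cite: ForbesShpilkaVolk2018, Cor. 15 (seq.) = ToC Cor. 3.4, p. 20]
locator: paper:arxiv-1701.05328 p0015.txt:L7 -/
theorem FSV2018_cor15_holds : FSV2018_cor15 := by
  intro F _ _ a hyp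
  obtain ⟨b, n₀, hhit⟩ := hyp
  refine ⟨26 * b + 108, 26 * b + a + 112, max n₀ 2, fun n hn => ?_⟩
  have hn₀ : n₀ ≤ n := (le_max_left _ _).trans hn
  have hn2 : 2 ≤ n := (le_max_right _ _).trans hn
  obtain ⟨p, U, hp, hU, hx, hdeg, hcov⟩ := RazUniversal.exists_universalCircuit F n (n ^ b) n
  have hpn : p ≤ n ^ (26 * b + 108) :=
    hp.trans ((Nat.mul_le_mul_right _ (by norm_num)).trans (FSV2018.cor15_poly hn2))
  have hUn : complexity U ≤ n ^ (26 * b + 108) := hU.trans (FSV2018.cor15_poly hn2)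
  let G : degLEMonomials n → MvPolynomial (Fin p) F := fun m =>
    coeff (m : Fin n →₀ ℕ) (sumAlgEquiv F (Fin n) (Fin p) U)
  have hgen : IsHittingSetGenerator (Distinguishers F n a) G := by
    refine (hhit n hn₀).isHittingSetGenerator_of_covers fun f hf => ?_
    obtain ⟨α, hα⟩ := hcov f hf.1 hf.2
    refine ⟨α, funext fun m => ?_⟩
    rw [genOutput_apply, coeffVector_apply, ← hα, FSV2018.coeff_aeval_sumElim]
  have hsucc : IsSuccinctGenerator (degLEMonomials n) (SmallCircuits F n (26 * b + 108)) G := by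
    intro α
    refine ⟨aeval (Sum.elim X fun j => C (α j)) U,
      ⟨FSV2018.totalDegree_aeval_sumElim_le hx α,
        (complexity_le_of_isProjection (FSV2018.isProjection_aeval_sumElim U α)).trans hUn⟩,
      funext fun m => ?_⟩
    rw [coeffVector_apply, genOutput_apply, FSV2018.coeff_aeval_sumElim]
  have hΔ : ∀ D ∈ Distinguishers F n a, D.totalDegree ≤ ((2 * n).choose n) ^ a := fun D hD => hD.2
  have hδ : ∀ m, (G m).totalDegree ≤ 3 * n + 1 := fun m =>
    (FSV2018.totalDegree_coeff_sumAlgEquiv_le U _).trans hdeg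
  obtain ⟨S, -, hS⟩ := (Set.infinite_univ (α := F)).exists_subset_card_eq
    ((3 * n + 1) * ((2 * n).choose n) ^ a + 1)
  obtain ⟨H, hH𝒞, hHcard, hHhit⟩ :=
    FSV2018.exists_finset_hittingSet_of_generator hΔ hδ hgen hsucc S hS.ge
  exact ⟨H, hH𝒞, hHcard.trans (FSV2018.cor15_card hn2 hpn), hHhit⟩


end Literature.Barriers.ValiantsHypothesis

end
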